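import Summits.Ventures.PercRepro.Night2LocalD2CoverPairDefs

/-!
# PercRepro — the «covering + pair» certificate of the local form at `|E ∖ cl B| ≥ q + 1` (night-2, gen 14)

Columns and the theorem for the rule `cpW` of Night2LocalD2CoverPairDefs.  **`localShadowHall_of_cover_pair`**: at a
rank-`(q+1)` flat `G` with `|E ∖ G| + 2 ≤ q`, if every member `B` below `G` has `|E ∖ cl B| ≥ q + 1`, then the
local form (LI_G) holds — the threshold `|E ∖ cl B| ≥ q + 2` of `localShadowHall_of_thin` lowered by one.

Columns: a shadow set `S` has at most `κ₀ := #coloops S ≤ q + 1` covering preimages, each of weight `≤ 1/(q+1)`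
(`cpCov_le`), and its pair preimages `B` (`pairPre`) have `S ∖ B` a series pair of `S` (`B ↦ S ∖ B` injective,
`card_pairPre_le`), each of weight `≤ 1/(q+1)²` (`cpPair_le`, as `|G ∖ cl B| ≥ 3`); with
`2·#seriesPairs ≤ (q+2−κ₀)(q+1−κ₀)` (`two_mul_card_seriesPairs_le`) the column is at most
`κ₀/(q+1) + (q+2−κ₀)(q+1−κ₀)/(2(q+1)²) ≤ 1` (`cp_col_arith`: the slack is `(q+1−κ₀)(κ₀+q)/(2(q+1)²) ≥ 0`).

Instance of record: `q = 4`, `|E ∖ G| = 2` — the (6,4) shadow row's last cell (`shadowHall_six_four_of_local_two`)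
at the rank-5 flats all of whose members have `|G ∖ cl B| ≥ 3`, i.e. whose carrying hyperplanes miss at least three
points of `G` (**`localShadowHall_d2_of_three_le`**); the members with `|G ∖ cl B| ≤ 2` (a coloop or a series pair
of `M|G` carrying members) remain the open cell.
-/

namespace PercRepro.Shadow

open Finset PerFlat ThmH

variable {α : Type*} [DecidableEq α] {M : Matroid α} [M.Finite]

/-! ## Columns -/

open scoped Classical in
/-- The covering part of a column is the sum over the covering preimages. -/
theorem sum_cpW_cov_col (q : ℕ) (G S : Finset α) :
    ∑ B ∈ membersIn M (Uq M (q + 2) q) G,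
        (if B ∈ membersIn M (Uq M (q + 2) q) G ∧ S ∈ coverSets M B G then cpCov M q B else 0) =
      ∑ B ∈ coverPreimages M (Uq M (q + 2) q) G S, cpCov M q B := by
  unfold coverPreimages
  rw [Finset.sum_filter]
  apply Finset.sum_congr rfl
  intro B hB
  simp only [hB, true_and]

open scoped Classical in
/-- For one member, at most one 2-subset `P` of `G ∖ cl B` has `S = B ∪ P` (then `P = S ∖ B`). -/
theorem sum_pair_ite_le {q : ℕ} {G : Finset α} {B : Finset α} (hB : B ∈ membersIn M (Uq M (q + 2) q) G)
    (S : Finset α) :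
    ∑ P ∈ Finset.powersetCard 2 (G \ clF M B), (if S = B ∪ P then cpPair M q G B else 0) ≤
      if (∃ P ∈ Finset.powersetCard 2 (G \ clF M B), S = B ∪ P) then cpPair M q G B else 0 := by
  have hBU : B ∈ Uq M (q + 2) q := (mem_membersIn.1 hB).1
  rw [← Finset.sum_filter]
  have hle : ((Finset.powersetCard 2 (G \ clF M B)).filter (fun P => S = B ∪ P)).card ≤ 1 := by
    rw [Finset.card_le_one]
    intro P hP P' hP'
    rw [Finset.mem_filter, Finset.mem_powersetCard] at hP hP'
    have key : ∀ Q, Q ⊆ G \ clF M B → S = B ∪ Q → Q = S \ B := by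
      intro Q hQ hSQ
      rw [hSQ, Finset.union_sdiff_left]
      symm
      rw [Finset.sdiff_eq_self_iff_disjoint, Finset.disjoint_left]
      intro e heQ heB
      exact (Finset.mem_sdiff.1 (hQ heQ)).2 (subset_clF hBU heB)
    rw [key P hP.1.1 hP.2, key P' hP'.1.1 hP'.2]
  rw [Finset.sum_const, nsmul_eq_mul]
  split_ifs with hex
  · have : ((Finset.powersetCard 2 (G \ clF M B)).filter (fun P => S = B ∪ P)).card ≤ 1 := hle
    have hcast : (((Finset.powersetCard 2 (G \ clF M B)).filter (fun P => S = B ∪ P)).card : ℚ) ≤ 1 := by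
      exact_mod_cast this
    calc _ ≤ (1 : ℚ) * cpPair M q G B := mul_le_mul_of_nonneg_right hcast (cpPair_nonneg q G B)
      _ = _ := one_mul _
  · have hempty : (Finset.powersetCard 2 (G \ clF M B)).filter (fun P => S = B ∪ P) = ∅ := by
      rw [Finset.filter_eq_empty_iff]
      intro P hP hSP
      exact hex ⟨P, hP, hSP⟩
    rw [hempty, Finset.card_empty]
    simp

open scoped Classical in
/-- The pair preimages of `S`: the members `B` with `S = B ∪ P` for a 2-subset `P` of `G ∖ cl B`. -/
noncomputable def pairPre (M : Matroid α) [M.Finite] (q : ℕ) (G S : Finset α) : Finset (Finset α) :=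
  (membersIn M (Uq M (q + 2) q) G).filter (fun B => ∃ P ∈ Finset.powersetCard 2 (G \ clF M B), S = B ∪ P)

open scoped Classical in
/-- `S ∖ B` is a series pair of `S` for every pair preimage `B` of the shadow set `S`. -/
theorem sdiff_mem_seriesPairs_of_pairPre {q : ℕ} {G : Finset α} (hG : G ∈ flatsQ M (q + 1))
    {S : Finset α} (hS : S ∈ shadowAt M (q + 2) q (Uq M (q + 2) q) G) {B : Finset α}
    (hB : B ∈ pairPre M q G S) : S \ B ∈ seriesPairs M S q := by
  unfold pairPre at hB
  rw [Finset.mem_filter] at hB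
  obtain ⟨hBm, P, hP, rfl⟩ := hB
  have hBU : B ∈ Uq M (q + 2) q := (mem_membersIn.1 hBm).1
  rw [Finset.mem_powersetCard] at hP
  obtain ⟨hPsub, hPcard⟩ := hP
  have hdisj : Disjoint B P := by
    rw [Finset.disjoint_left]
    intro e heB heP
    exact (Finset.mem_sdiff.1 (hPsub heP)).2 (subset_clF hBU heB)
  have hsd : (B ∪ P) \ B = P := by
    rw [Finset.union_sdiff_left, Finset.sdiff_eq_self_iff_disjoint]
    exact hdisj.symm
  rw [hsd]
  obtain ⟨x, y, hxy, rfl⟩ := Finset.card_eq_two.1 hPcard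
  have hx : x ∈ G \ clF M B := hPsub (by simp)
  have hy : y ∈ G \ clF M B := hPsub (by simp)
  have hGg : G ⊆ gr M := (mem_flatsQ.1 hG).1
  have hxB : x ∉ B := notMem_of_notMem_clF hBU (Finset.mem_sdiff.1 hx).2
  have hyB : y ∉ B := notMem_of_notMem_clF hBU (Finset.mem_sdiff.1 hy).2
  -- the two covering sets have rank `q + 1`, `B` has rank `q`
  have hrkcov : ∀ z ∈ G \ clF M B, rkN M (insert z B) = q + 1 := by
    intro z hz
    have hY := insert_mem_Yq hBU (hGg (Finset.mem_sdiff.1 hz).1) (Finset.mem_sdiff.1 hz).2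
    unfold rkN
    rw [eRk_eq_of_mem_Yq_diag hY]
    rfl
  have hrkB : rkN M B = q := by
    unfold rkN
    rw [(mem_Uq.1 hBU).2.1]
    rfl
  unfold seriesPairs
  rw [Finset.mem_filter, Finset.mem_powersetCard]
  refine ⟨⟨?_, Finset.card_pair hxy⟩, ?_⟩
  · intro e he
    rw [Finset.mem_insert, Finset.mem_singleton] at he
    rcases he with rfl | rfl
    · exact Finset.mem_union_right _ (by simp)
    · exact Finset.mem_union_right _ (by simp)
  · intro a ha b hb hab
    rw [Finset.mem_insert, Finset.mem_singleton] at ha hb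
    -- the four combinations reduce to `{a, b} = {x, y}`
    have hcore : ∀ a b, a ∈ ({x, y} : Finset α) → b ∈ ({x, y} : Finset α) → a ≠ b →
        SeriesPair M (B ∪ {x, y}) q a b := by
      intro a b ha hb hab
      rw [Finset.mem_insert, Finset.mem_singleton] at ha hb
      have hab' : ({a, b} : Finset α) = {x, y} := by
        rcases ha with rfl | rfl <;> rcases hb with rfl | rfl
        · exact absurd rfl hab
        · rfl
        · exact Finset.pair_comm _ _
        · exact absurd rfl hab
      have haG : a ∈ G \ clF M B := by rcases ha with rfl | rfl <;> assumption
      have hbG : b ∈ G \ clF M B := by rcases hb with rfl | rfl <;> assumption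
      have haB : a ∉ B := notMem_of_notMem_clF hBU (Finset.mem_sdiff.1 haG).2
      have hbB : b ∉ B := notMem_of_notMem_clF hBU (Finset.mem_sdiff.1 hbG).2
      refine ⟨Finset.mem_union_right _ (by rw [← hab']; simp),
        Finset.mem_union_right _ (by rw [← hab']; simp), hab, ?_, ?_, ?_⟩
      · have : (B ∪ {x, y}).erase a = insert b B := by
          rw [← hab']
          ext e
          simp only [Finset.mem_erase, Finset.mem_union, Finset.mem_insert, Finset.mem_singleton]
          constructor
          · rintro ⟨hea, he⟩
            rcases he with he | he | he
            · exact Or.inr he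
            · exact absurd he hea
            · exact Or.inl he
          · rintro (rfl | he)
            · exact ⟨hab.symm, Or.inr (Or.inr rfl)⟩
            · exact ⟨fun h => haB (h ▸ he), Or.inl he⟩
        rw [this]
        exact hrkcov b hbG
      · have : (B ∪ {x, y}).erase b = insert a B := by
          rw [← hab']
          ext e
          simp only [Finset.mem_erase, Finset.mem_union, Finset.mem_insert, Finset.mem_singleton]
          constructor
          · rintro ⟨heb, he⟩
            rcases he with he | he | he
            · exact Or.inr he
            · exact Or.inl he
            · exact absurd he heb
          · rintro (rfl | he)
            · exact ⟨hab, Or.inr (Or.inl rfl)⟩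
            · exact ⟨fun h => hbB (h ▸ he), Or.inl he⟩
        rw [this]
        exact hrkcov a haG
      · have : (B ∪ {x, y}) \ {a, b} = B := by
          rw [hab', Finset.union_sdiff_right, Finset.sdiff_eq_self_iff_disjoint]
          exact hdisj
        rw [this]
        exact hrkB
    exact hcore a b (by rcases ha with rfl | rfl <;> simp) (by rcases hb with rfl | rfl <;> simp) hab

open scoped Classical in
/-- The pair preimages of `S` inject into its series pairs: `#pairPre S ≤ #seriesPairs S`. -/
theorem card_pairPre_le {q : ℕ} {G : Finset α} (hG : G ∈ flatsQ M (q + 1))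
    {S : Finset α} (hS : S ∈ shadowAt M (q + 2) q (Uq M (q + 2) q) G) :
    (pairPre M q G S).card ≤ (seriesPairs M S q).card := by
  apply Finset.card_le_card_of_injOn (fun B => S \ B)
  · intro B hB
    exact sdiff_mem_seriesPairs_of_pairPre hG hS (Finset.mem_coe.1 hB)
  · intro B hB B' hB' hBB'
    have hsub : ∀ C ∈ pairPre M q G S, C ⊆ S := by
      intro C hC
      unfold pairPre at hC
      rw [Finset.mem_filter] at hC
      obtain ⟨-, P, -, rfl⟩ := hC
      exact Finset.subset_union_left
    have h1 := hsub B (Finset.mem_coe.1 hB)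
    have h2 := hsub B' (Finset.mem_coe.1 hB')
    have h3 : S \ B = S \ B' := hBB'
    calc B = S \ (S \ B) := (Finset.sdiff_sdiff_eq_self h1).symm
      _ = S \ (S \ B') := by rw [h3]
      _ = B' := Finset.sdiff_sdiff_eq_self h2

open scoped Classical in
/-- The pair part of a column is at most `#pairPre S / (q+1)²` when every member has `|G ∖ cl B| ≥ 3`. -/
theorem sum_cpW_pair_col_le {q : ℕ} {G : Finset α} (hm : ∀ B ∈ membersIn M (Uq M (q + 2) q) G,
    3 ≤ (G \ clF M B).card) (S : Finset α) :
    ∑ B ∈ membersIn M (Uq M (q + 2) q) G, (if B ∈ membersIn M (Uq M (q + 2) q) G then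
        ∑ P ∈ Finset.powersetCard 2 (G \ clF M B), (if S = B ∪ P then cpPair M q G B else 0) else 0) ≤
      ((pairPre M q G S).card : ℚ) * (1 / (((q : ℚ) + 1) ^ 2)) := by
  calc ∑ B ∈ membersIn M (Uq M (q + 2) q) G, (if B ∈ membersIn M (Uq M (q + 2) q) G then
        ∑ P ∈ Finset.powersetCard 2 (G \ clF M B), (if S = B ∪ P then cpPair M q G B else 0) else 0)
      ≤ ∑ B ∈ membersIn M (Uq M (q + 2) q) G,
          (if (∃ P ∈ Finset.powersetCard 2 (G \ clF M B), S = B ∪ P) then 1 / (((q : ℚ) + 1) ^ 2) else 0) := by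
        apply Finset.sum_le_sum
        intro B hB
        simp only [hB, if_true]
        refine (sum_pair_ite_le hB S).trans ?_
        split_ifs
        · exact cpPair_le (hm B hB)
        · exact le_refl _
    _ = ((pairPre M q G S).card : ℚ) * (1 / (((q : ℚ) + 1) ^ 2)) := by
        rw [← Finset.sum_filter, Finset.sum_const, nsmul_eq_mul]
        rfl

/-- The arithmetic of the column: `a/(q+1) + (q+2−a)(q+1−a)/(2(q+1)²) ≤ 1` for `a ≤ q + 1`. -/
theorem cp_col_arith {q a : ℕ} (ha : a ≤ q + 1) :
    (a : ℚ) * (1 / ((q : ℚ) + 1)) + (((q + 2 - a) * (q + 1 - a) : ℕ) : ℚ) / 2 * (1 / (((q : ℚ) + 1) ^ 2)) ≤ 1 := by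
  have h1 : (((q + 2 - a : ℕ) : ℚ)) = (q : ℚ) + 2 - a := by
    rw [Nat.cast_sub (by omega)]; push_cast; ring
  have h2 : (((q + 1 - a : ℕ) : ℚ)) = (q : ℚ) + 1 - a := by
    rw [Nat.cast_sub (by omega)]; push_cast; ring
  rw [Nat.cast_mul, h1, h2]
  have hq : (0 : ℚ) < (q : ℚ) + 1 := by positivity
  have ha' : (a : ℚ) ≤ (q : ℚ) + 1 := by exact_mod_cast ha
  have ha0 : (0 : ℚ) ≤ (a : ℚ) := by positivity
  have hq0 : (0 : ℚ) ≤ (q : ℚ) := by positivity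
  have hpos : (0 : ℚ) < 2 * ((q : ℚ) + 1) ^ 2 := by positivity
  have hnn : 0 ≤ ((q : ℚ) + 1 - a) * (a + q) := mul_nonneg (sub_nonneg.2 ha') (by positivity)
  have key : (a : ℚ) * (1 / ((q : ℚ) + 1)) +
      ((q : ℚ) + 2 - a) * ((q : ℚ) + 1 - a) / 2 * (1 / (((q : ℚ) + 1) ^ 2)) =
      1 - ((q : ℚ) + 1 - a) * (a + q) / (2 * ((q : ℚ) + 1) ^ 2) := by
    field_simp
    ring
  have hdiv := div_nonneg hnn hpos.le
  linarith [key, hdiv]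

open scoped Classical in
/-- **The column bound**: at every shadow set `S` with closure `G`, `Σ_B cpW B S ≤ 1`, when every member `B` below
`G` has `|E ∖ cl B| ≥ q + 1` and `|G ∖ cl B| ≥ 3`. -/
theorem sum_cpW_col_le {q : ℕ} {G : Finset α} (hG : G ∈ flatsQ M (q + 1))
    (hmem : ∀ B ∈ membersIn M (Uq M (q + 2) q) G, q + 1 ≤ (gr M \ clF M B).card)
    (hm : ∀ B ∈ membersIn M (Uq M (q + 2) q) G, 3 ≤ (G \ clF M B).card)
    {S : Finset α} (hS : S ∈ shadowAt M (q + 2) q (Uq M (q + 2) q) G) :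
    ∑ B ∈ membersIn M (Uq M (q + 2) q) G, cpW M q G B S ≤ 1 := by
  have hSG : S ⊆ G := subset_of_mem_shadowAt hS
  have hSE : S ⊆ gr M := hSG.trans (mem_flatsQ.1 hG).1
  have hSY : S ∈ Yq M (q + 2) q := shadow_subset_Yq _ (mem_shadowAt.1 hS).1
  have hSr : rkN M S = q + 1 := by
    unfold rkN; rw [eRk_eq_of_mem_Yq_diag hSY]; rfl
  have hcol : (coloops M S).card ≤ q + 1 := card_coloops_le hSE (eRk_eq_of_mem_Yq_diag hSY)
  unfold cpW
  rw [Finset.sum_add_distrib, sum_cpW_cov_col]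
  -- covering part
  have hcov : ∑ B ∈ coverPreimages M (Uq M (q + 2) q) G S, cpCov M q B ≤
      ((coloops M S).card : ℚ) * (1 / ((q : ℚ) + 1)) := by
    calc ∑ B ∈ coverPreimages M (Uq M (q + 2) q) G S, cpCov M q B
        ≤ ∑ B ∈ coverPreimages M (Uq M (q + 2) q) G S, 1 / ((q : ℚ) + 1) := by
          apply Finset.sum_le_sum
          intro B hB
          exact cpCov_le (hmem B (mem_coverPreimages.1 hB).1)
      _ = ((coverPreimages M (Uq M (q + 2) q) G S).card : ℚ) * (1 / ((q : ℚ) + 1)) := by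
          rw [Finset.sum_const, nsmul_eq_mul]
      _ ≤ ((coloops M S).card : ℚ) * (1 / ((q : ℚ) + 1)) := by
          apply mul_le_mul_of_nonneg_right _ (by positivity)
          exact_mod_cast card_coverPreimages_le_card_coloops (le_refl _) G S
  -- pair part
  have hpair := sum_cpW_pair_col_le hm S
  have hpp : ((pairPre M q G S).card : ℚ) ≤
      (((q + 2 - (coloops M S).card) * (q + 1 - (coloops M S).card) : ℕ) : ℚ) / 2 := by
    have h1 := card_pairPre_le hG hS
    have h2 := two_mul_card_seriesPairs_le hSE hSr
    have h3 : 2 * (pairPre M q G S).card ≤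
        (q + 2 - (coloops M S).card) * (q + 1 - (coloops M S).card) := by omega
    have h4 : (2 : ℚ) * ((pairPre M q G S).card : ℚ) ≤
        (((q + 2 - (coloops M S).card) * (q + 1 - (coloops M S).card) : ℕ) : ℚ) := by exact_mod_cast h3
    linarith
  calc _ ≤ ((coloops M S).card : ℚ) * (1 / ((q : ℚ) + 1)) +
      ((pairPre M q G S).card : ℚ) * (1 / (((q : ℚ) + 1) ^ 2)) := add_le_add hcov hpair
    _ ≤ ((coloops M S).card : ℚ) * (1 / ((q : ℚ) + 1)) +
      (((q + 2 - (coloops M S).card) * (q + 1 - (coloops M S).card) : ℕ) : ℚ) / 2 *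
        (1 / (((q : ℚ) + 1) ^ 2)) := by
        exact add_le_add (le_refl _) (mul_le_mul_of_nonneg_right hpp (by positivity))
    _ ≤ 1 := cp_col_arith hcol

/-! ## The theorem -/

open scoped Classical in
/-- **The «covering + pair» certificate.**  At a rank-`(q+1)` flat `G` with `|E ∖ G| + 2 ≤ q`, if every member
`B` below `G` has `|E ∖ cl B| ≥ q + 1`, then the local form (LI_G) holds — the thin theorem's threshold
`|E ∖ cl B| ≥ q + 2` lowered by one. -/
theorem localShadowHall_of_cover_pair {q : ℕ} {G : Finset α} (hG : G ∈ flatsQ M (q + 1))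
    (hd : (gr M \ G).card + 2 ≤ q)
    (hmem : ∀ B ∈ membersIn M (Uq M (q + 2) q) G, q + 1 ≤ (gr M \ clF M B).card) :
    LocalShadowHall M q G := by
  have hGg : G ⊆ gr M := (mem_flatsQ.1 hG).1
  have hm : ∀ B ∈ membersIn M (Uq M (q + 2) q) G, 3 ≤ (G \ clF M B).card := by
    intro B hB
    have h1 := hmem B hB
    have h2 := card_sdiff_clF_eq_add hGg (mem_membersIn.1 hB).2
    omega
  apply localShadowHall_of_full_matching (cpW M q G)
  · intro B S
    exact cpW_nonneg q G B S
  · intro B S h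
    unfold cpW at h
    by_cases h1 : (if B ∈ membersIn M (Uq M (q + 2) q) G ∧ S ∈ coverSets M B G then cpCov M q B else 0) = 0
    · rw [h1, zero_add] at h
      split_ifs at h with hB
      · obtain ⟨P, hP, hne⟩ := Finset.exists_ne_zero_of_sum_ne_zero h
        split_ifs at hne with hSP
        · rw [hSP]; exact Finset.subset_union_left
        · exact absurd rfl hne
      · exact absurd rfl h
    · split_ifs at h1 with hc
      · obtain ⟨z, -, rfl⟩ := mem_coverSets.1 hc.2
        exact Finset.subset_insert _ _
      · exact absurd rfl h1
  · intro S hS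
    exact sum_cpW_col_le hG hmem hm hS
  · intro B hB
    exact row_cpW_ge hG hB (hmem B hB) (hm B hB)

/-- **The (6,4) instance** (`q = 4`, `|E ∖ G| = 2`): (LI_G) at a rank-5 flat with two points outside whose members
all have `|G ∖ cl B| ≥ 3`. -/
theorem localShadowHall_d2_of_three_le {G : Finset α} (hG : G ∈ flatsQ M (4 + 1))
    (hd : (gr M \ G).card = 2)
    (h3 : ∀ B ∈ membersIn M (Uq M (4 + 2) 4) G, 3 ≤ (G \ clF M B).card) :
    LocalShadowHall M 4 G := by
  apply localShadowHall_of_cover_pair hG (by omega)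
  intro B hB
  have h1 := h3 B hB
  have h2 := card_sdiff_clF_eq_add (mem_flatsQ.1 hG).1 (mem_membersIn.1 hB).2
  omega

end PercRepro.Shadow
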